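import Literature.NumberTheory.EllipticCurves.ModularSymbolsManinDrinfeldProofs
import Literature.NumberTheory.EllipticCurves.ModularSymbolsManin
import HarnessLib

/-!
# `[r]^±_f ∈ ℚ · Ω^±_f` with `Ω^±_f ≠ 0` for rational newforms, from `dim S₂(Γ₀(N)) ≥ g(X₀(N))`
# (provefact `Literature.NumberTheory.EllipticCurves.ModularForms.IsNewform0.exists_rat_smul_plusPeriod`, continued)

D-0014 keeps `Literature/` sorry-free by stating cited results as named facts `def X : Prop`.
This leaf file joins the two proved halves of the argument for the named facts

* `IsNewform0.exists_rat_smul_plusPeriod` (Manin 1972, Cor. 3.6 with Thm. 1.9: for a normalised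
  newform `f ∈ S₂(Γ₀(N))` with rational coefficients, `Ω⁺_f ≠ 0` and
  `re (plusSymbol f r) ∈ ℚ · Ω⁺_f` for every `r ∈ ℚ`),
* `IsNewform0.exists_rat_smul_minusPeriod` (the same for `Ω⁻_f` and `im (minusSymbol f r)`)

of `Literature.NumberTheory.EllipticCurves.ModularSymbols`, and records what is left.

1. `Literature.NumberTheory.EllipticCurves.ModularSymbolsManinDrinfeldProofs` proves the
   Manin–Drinfeld theorem for rational newforms
   (`exists_nsmul_modularSymbol_mem_periodLattice_of_isNewform0`, Manin 1972, Thm. 3.3, (20) and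
   Thm. 3.5, (22): closing the path `{∞, r}` with a Hecke operator `T_l`, `l ≡ 1 (mod N)` prime
   with `a_l ≠ l + 1`) and reduces both facts to the Eichler–Shimura lattice statement for the
   period homology `H ⊆ S₂(Γ₀(N))^∧`
   (`IsNewform0.exists_rat_smul_plusPeriod_of_periodHomology`: hypothesis
   `periodHomology_eq_span_basis N`, Diamond–Shurman §6.1).
2. `Literature.NumberTheory.EllipticCurves.ModularSymbolsManin` proves Manin's presentation of
   `H` by M-symbols and the rank bound `6 dim_ℚ ℚH + 3ε₂ + 4ε₃ + 6ε_∞ ≤ 12 + μ`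
   (`ManinCount.six_mul_finrank_span_periodHomology_le`, Manin 1972, Thm. 1.9; Cremona 1997,
   Thm. 2.1.2), so that `periodHomology_eq_span_basis N` follows from
   `dim_ℚ ℚH ≤ 2 dim_ℂ S₂(Γ₀(N))` (`periodHomology_eq_span_fin_two_mul_finrank_of_finrank_le`),
   hence from the genus-cum-dimension formula
   `12 dim_ℂ S₂(Γ₀(N)) + 3ε₂ + 4ε₃ + 6ε_∞ = 12 + μ` (the named fact
   `twelve_mul_finrank_cuspForm_two (Gamma0 N)` of `ModularCurveProofs`, Diamond–Shurman
   Thm. 3.1.1 with Thm. 3.5.1), of which it proves the half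
   `12 dim S₂(Γ₀(N)) + 3ε₂ + 4ε₃ + 6ε_∞ ≤ 12 + μ` unconditionally
   (`twelve_mul_finrank_cuspForm_two_add_le`, i.e. `dim S₂(Γ₀(N)) ≤ g(X₀(N))`).

Consequently (this file):

* `twelve_mul_finrank_cuspForm_two_gamma0_of_le`: the named fact
  `twelve_mul_finrank_cuspForm_two (Gamma0 N)` **is equivalent to its remaining half**
  `12 + μ ≤ 12 dim_ℂ S₂(Γ₀(N)) + 3ε₂ + 4ε₃ + 6ε_∞`, i.e. `dim S₂(Γ₀(N)) ≥ g(X₀(N))` — the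
  existence of `g` linearly independent cusp forms of weight `2` (holomorphic differentials on
  `X₀(N)`; Riemann–Roch, Diamond–Shurman Cor. 3.4.2 with §3.3), which is the one input not
  available at the Mathlib pin;
* `IsNewform0.exists_rat_smul_plusPeriod_of_finrank_le`, `…_minusPeriod_of_finrank_le`: both
  named facts from `dim_ℚ ℚH ≤ 2 dim_ℂ S₂(Γ₀(N))` (the sharpest purely modular-symbol form);
* `IsNewform0.exists_rat_smul_plusPeriod_of_genus`, `…_minusPeriod_of_genus`: both named facts
  from `twelve_mul_finrank_cuspForm_two (Gamma0 N)`;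
* `IsNewform0.exists_rat_smul_plusPeriod_of_le`, `…_minusPeriod_of_le`: both named facts from the
  bare inequality `12 + μ ≤ 12 dim_ℂ S₂(Γ₀(N)) + 3ε₂ + 4ε₃ + 6ε_∞`.

So `theorem IsNewform0.exists_rat_smul_plusPeriod_holds` is the one-liner
`IsNewform0.exists_rat_smul_plusPeriod_of_genus twelve_mul_finrank_cuspForm_two_holds` as soon as
the genus formula for `X₀(N)` (equivalently, by the above, the lower bound
`dim S₂(Γ₀(N)) ≥ g(X₀(N))`) is a theorem. The first clause `Ω⁺_f ≠ 0` genuinely needs it: with the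
normalisation of `plusPeriod` in `ModularSymbols` it says that `re Λ_f` is infinite cyclic, i.e.
`rank_ℤ Λ_f = 2` for the period lattice of `f`, the rank half of Eichler–Shimura (the rationality
clause alone does not, cf. `ModularSymbolsNormalizedSymbolProofs`).

## References

* Ju. I. Manin, *Parabolic points and zeta functions of modular curves*, Izv. Akad. Nauk SSSR
  Ser. Mat. 36 (1972), 19–66; Engl. transl. Math. USSR-Izv. 6 (1972), 19–64,
  doi:10.1070/IM1972v006n01ABEH001867: Thm. 1.9, Thm. 3.3 (20), Thm. 3.5 (22), Cor. 3.6.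
* J. E. Cremona, *Algorithms for modular elliptic curves*, 2nd ed., CUP 1997, Thm. 2.1.2, §2.8,
  §2.10 ((2.10.1)–(2.10.2)).
* F. Diamond, J. Shurman, *A first course in modular forms*, GTM 228, Springer 2005, Thm. 3.1.1,
  Cor. 3.4.2, Thm. 3.5.1, §6.1.
-/

noncomputable section

open scoped MatrixGroups ModularForm

open CongruenceSubgroup Module Submodule

namespace Literature.NumberTheory.EllipticCurves.ModularForms

section Genus

variable (N : ℕ) [NeZero N]

/-- **The genus-cum-dimension formula for `X₀(N)` is equivalent to its lower-bound half.** Given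
`12 + μ ≤ 12 dim_ℂ S₂(Γ₀(N)) + 3ε₂ + 4ε₃ + 6ε_∞` (`dim S₂(Γ₀(N)) ≥ g(X₀(N))`: there are `g`
linearly independent weight-`2` cusp forms, Diamond–Shurman Thm. 3.5.1 for `k = 2` via
Riemann–Roch, Cor. 3.4.2), the named fact `twelve_mul_finrank_cuspForm_two (Gamma0 N)`
(`12 dim S₂(Γ₀(N)) + 3ε₂ + 4ε₃ + 6ε_∞ = 12 + μ`, Thm. 3.1.1 with Thm. 3.5.1) holds, the reverse
inequality being Manin's rank bound (`twelve_mul_finrank_cuspForm_two_add_le` of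
`ModularSymbolsManin`) and `−I ∈ Γ₀(N)` (`adjoinNegI_gamma0`).
[cite: DiamondShurman2005, Thm. 3.5.1 with Thm. 3.1.1] -/
theorem twelve_mul_finrank_cuspForm_two_gamma0_of_le
    (h : 12 + (Gamma0 N).index ≤
      12 * finrank ℂ (CuspForm (Gamma0 N) 2) + 3 * ellipticPointCount (Gamma0 N) 2 +
        4 * ellipticPointCount (Gamma0 N) 3 +
        6 * Nat.card (CuspOrbits (Gamma0 N : Subgroup (GL (Fin 2) ℝ)))) :
    twelve_mul_finrank_cuspForm_two (Gamma0 N) := fun _ ↦ by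
  have h' := twelve_mul_finrank_cuspForm_two_add_le N
  rw [adjoinNegI_gamma0]
  omega

/-- Conversely the named fact gives the lower bound (trivially; recorded for the equivalence).
[cite: DiamondShurman2005, Thm. 3.5.1 with Thm. 3.1.1] -/
theorem twelve_add_index_le_of_twelve_mul (h : twelve_mul_finrank_cuspForm_two (Gamma0 N)) :
    12 + (Gamma0 N).index ≤
      12 * finrank ℂ (CuspForm (Gamma0 N) 2) + 3 * ellipticPointCount (Gamma0 N) 2 +
        4 * ellipticPointCount (Gamma0 N) 3 +
        6 * Nat.card (CuspOrbits (Gamma0 N : Subgroup (GL (Fin 2) ℝ))) := by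
  have h' := h (Gamma0_is_congruence N)
  rw [adjoinNegI_gamma0] at h'
  omega

end Genus

section Newform

variable {N : ℕ} [NeZero N] {f : CuspForm (Gamma0 N) 2}

/-- **`IsNewform0.exists_rat_smul_plusPeriod` from `dim_ℚ ℚH ≤ 2 dim_ℂ S₂(Γ₀(N))`**: if the
rational span of the period homology `H ⊆ S₂(Γ₀(N))^∧` has dimension at most
`2 dim_ℂ S₂(Γ₀(N)) = dim_ℝ S₂(Γ₀(N))^∧` (the rank half of "`H₁(X₀(N), ℤ) ≅ ℤ^{2g}` is a lattice in
`Ω¹(X₀(N))^∧`", Diamond–Shurman §6.1), then `H` is the `ℤ`-span of an `ℝ`-basis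
(`periodHomology_eq_span_fin_two_mul_finrank_of_finrank_le`, `periodHomology_eq_span_basis_of`),
and the Manin–Drinfeld reduction `IsNewform0.exists_rat_smul_plusPeriod_of_periodHomology`
applies. [cite: Manin1972, Cor. 3.6 with Thm. 1.9] -/
theorem IsNewform0.exists_rat_smul_plusPeriod_of_finrank_le
    (h : finrank ℚ (span ℚ (periodHomology N : Set (Module.Dual ℂ (CuspForm (Gamma0 N) 2)))) ≤
      2 * finrank ℂ (CuspForm (Gamma0 N) 2)) :
    IsNewform0.exists_rat_smul_plusPeriod (f := f) :=
  IsNewform0.exists_rat_smul_plusPeriod_of_periodHomology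
    (periodHomology_eq_span_basis_of N
      (periodHomology_eq_span_fin_two_mul_finrank_of_finrank_le N h))

/-- **`IsNewform0.exists_rat_smul_minusPeriod` from `dim_ℚ ℚH ≤ 2 dim_ℂ S₂(Γ₀(N))`.**
[cite: Manin1972, Cor. 3.6] -/
theorem IsNewform0.exists_rat_smul_minusPeriod_of_finrank_le
    (h : finrank ℚ (span ℚ (periodHomology N : Set (Module.Dual ℂ (CuspForm (Gamma0 N) 2)))) ≤
      2 * finrank ℂ (CuspForm (Gamma0 N) 2)) :
    IsNewform0.exists_rat_smul_minusPeriod (f := f) :=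
  IsNewform0.exists_rat_smul_minusPeriod_of_periodHomology
    (periodHomology_eq_span_basis_of N
      (periodHomology_eq_span_fin_two_mul_finrank_of_finrank_le N h))

/-- **`IsNewform0.exists_rat_smul_plusPeriod` from the genus-cum-dimension formula for `X₀(N)`**
(the named fact `twelve_mul_finrank_cuspForm_two (Gamma0 N)`, Diamond–Shurman Thm. 3.1.1 with
Thm. 3.5.1): by Manin's rank bound it yields `periodHomology_eq_span_basis N`
(`periodHomology_eq_span_basis_of_genus`), whence the target by the Manin–Drinfeld reduction
(Manin 1972, Cor. 3.6 with Thm. 1.9). [cite: Manin1972, Cor. 3.6 with Thm. 1.9] -/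
theorem IsNewform0.exists_rat_smul_plusPeriod_of_genus
    (h₁ : twelve_mul_finrank_cuspForm_two (Gamma0 N)) :
    IsNewform0.exists_rat_smul_plusPeriod (f := f) :=
  IsNewform0.exists_rat_smul_plusPeriod_of_periodHomology
    (periodHomology_eq_span_basis_of_genus N h₁)

/-- **`IsNewform0.exists_rat_smul_minusPeriod` from the genus-cum-dimension formula for `X₀(N)`.**
[cite: Manin1972, Cor. 3.6] -/
theorem IsNewform0.exists_rat_smul_minusPeriod_of_genus
    (h₁ : twelve_mul_finrank_cuspForm_two (Gamma0 N)) :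
    IsNewform0.exists_rat_smul_minusPeriod (f := f) :=
  IsNewform0.exists_rat_smul_minusPeriod_of_periodHomology
    (periodHomology_eq_span_basis_of_genus N h₁)

/-- **`IsNewform0.exists_rat_smul_plusPeriod` from `dim S₂(Γ₀(N)) ≥ g(X₀(N))` alone**, in the
cleared-denominator form `12 + μ ≤ 12 dim_ℂ S₂(Γ₀(N)) + 3ε₂ + 4ε₃ + 6ε_∞` (the existence half of
Diamond–Shurman Thm. 3.5.1, `k = 2`; the other half is the theorem
`twelve_mul_finrank_cuspForm_two_add_le`). [cite: Manin1972, Cor. 3.6 with Thm. 1.9] -/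
theorem IsNewform0.exists_rat_smul_plusPeriod_of_le
    (h : 12 + (Gamma0 N).index ≤
      12 * finrank ℂ (CuspForm (Gamma0 N) 2) + 3 * ellipticPointCount (Gamma0 N) 2 +
        4 * ellipticPointCount (Gamma0 N) 3 +
        6 * Nat.card (CuspOrbits (Gamma0 N : Subgroup (GL (Fin 2) ℝ)))) :
    IsNewform0.exists_rat_smul_plusPeriod (f := f) :=
  IsNewform0.exists_rat_smul_plusPeriod_of_genus (twelve_mul_finrank_cuspForm_two_gamma0_of_le N h)

/-- **`IsNewform0.exists_rat_smul_minusPeriod` from `dim S₂(Γ₀(N)) ≥ g(X₀(N))` alone.**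
[cite: Manin1972, Cor. 3.6] -/
theorem IsNewform0.exists_rat_smul_minusPeriod_of_le
    (h : 12 + (Gamma0 N).index ≤
      12 * finrank ℂ (CuspForm (Gamma0 N) 2) + 3 * ellipticPointCount (Gamma0 N) 2 +
        4 * ellipticPointCount (Gamma0 N) 3 +
        6 * Nat.card (CuspOrbits (Gamma0 N : Subgroup (GL (Fin 2) ℝ)))) :
    IsNewform0.exists_rat_smul_minusPeriod (f := f) :=
  IsNewform0.exists_rat_smul_minusPeriod_of_genus (twelve_mul_finrank_cuspForm_two_gamma0_of_le N h)

end Newform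

end Literature.NumberTheory.EllipticCurves.ModularForms

end
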